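import Mathlib

/-!
# Walsh–Fourier toolkit on `𝔽₂^m` and parity boundaries
(helper for stub `stub_perfectCompleteness` of line `xor-door-perfect-completeness`, crux `ConvexGateBlind`,
item stmt-PneNP-10680)

Elementary finite identities used by Grigoriev's perfect-completeness pseudo-expectation
(Grigoriev, *Theoret. Comput. Sci.* 259 (2001) 613–622; Schoenebeck, FOCS 2008) for Tseitin
contradictions, over the cube `Fin m → ZMod 2` (the variable space of the 3-sparse pool of the line):

* signs `sgn a = (-1)^a` and Walsh characters `chi S y = ∏_{i∈S} (-1)^{y i}`, multiplicativity
  `chi S * chi T = chi (S ∆ T)`, the two orthogonality sums (`sum_chi` over points, `sum_chi_index`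
  over index sets);
* coefficients `coeff f S = 2^{-m} ∑_y f y · chi S y`, the linear form `coeffLin S`, Fourier inversion,
  `coeff (chi T) S = [S = T]`;
* vanishing of coefficients: off the support of a junta (`coeff_eq_zero_of_not_subset`) and above the
  degree of a linear combination of `k`-juntas (`coeff_eq_zero_of_mem_span`);
* parity boundaries of a family of variable sets `A : V → Finset (Fin m)` (a Tseitin / XOR instance):
  `bsum`, `bd A T = {x | x lies in an odd number of A v, v ∈ T}`, `charge`, and their additivity under
  symmetric difference.

The `Fin m → Bool` toolkit `Literature.Computability.Complexity.BooleanFourier` is the model; the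
`ZMod 2` copies are re-proved here (the group structure `y ↦ y + w` is used) rather than transported.
-/

set_option linter.dupNamespace false -- `Summit.PneNP.PneNP.…`: summit = sub-problem (D-0017)

namespace Summit.PneNP.PneNP.Theorems.XorDoor.PC

open Finset

noncomputable section

/-! ### Signs on `𝔽₂` -/

/-- The real sign `(-1)^a` of `a : 𝔽₂`. [folklore] -/
def sgn (a : ZMod 2) : ℝ := if a = 0 then 1 else -1

/-- `sgn 0 = 1`. [folklore] -/
@[simp] theorem sgn_zero : sgn 0 = 1 := by simp [sgn]

/-- `sgn 1 = -1`. [folklore] -/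
@[simp] theorem sgn_one : sgn 1 = -1 := by simp [sgn]

/-- Every element of `𝔽₂` is `0` or `1`. [folklore] -/
theorem eq_zero_or_eq_one (a : ZMod 2) : a = 0 ∨ a = 1 := by
  fin_cases a
  · exact Or.inl rfl
  · exact Or.inr rfl

/-- `sgn` is a character of `(𝔽₂, +)`. [folklore] -/
theorem sgn_add (a b : ZMod 2) : sgn (a + b) = sgn a * sgn b := by
  have h11 : (1 + 1 : ZMod 2) = 0 := by decide
  rcases eq_zero_or_eq_one a with rfl | rfl <;> rcases eq_zero_or_eq_one b with rfl | rfl <;>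
    simp [sgn, h11]

/-- `sgn a ^ 2 = 1`. [folklore] -/
theorem sgn_mul_self (a : ZMod 2) : sgn a * sgn a = 1 := by
  unfold sgn; split_ifs <;> norm_num

/-- `sgn a = ±1`. [folklore] -/
theorem sgn_eq_one_or (a : ZMod 2) : sgn a = 1 ∨ sgn a = -1 := by
  unfold sgn; split_ifs <;> simp

/-- `sgn` is injective. [folklore] -/
theorem sgn_eq_sgn_iff {a b : ZMod 2} : sgn a = sgn b ↔ a = b := by
  rcases eq_zero_or_eq_one a with rfl | rfl <;> rcases eq_zero_or_eq_one b with rfl | rfl <;>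
    norm_num [sgn]

/-- `∑_a sgn a = 0`. [folklore] -/
theorem sum_sgn : ∑ a : ZMod 2, sgn a = 0 := by
  have h : (univ : Finset (ZMod 2)) = {0, 1} := by decide
  rw [h, sum_pair (by decide)]
  simp

variable {m : ℕ}

/-! ### Walsh characters -/

/-- The Walsh character `χ_S(y) = ∏_{i ∈ S} (-1)^{y i}` of `𝔽₂^m`. [folklore] -/
def chi (S : Finset (Fin m)) (y : Fin m → ZMod 2) : ℝ := ∏ i ∈ S, sgn (y i)

/-- `χ_∅ = 1`. [folklore] -/
@[simp] theorem chi_empty (y : Fin m → ZMod 2) : chi ∅ y = 1 := by simp [chi]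

/-- A character as a product over all coordinates. [folklore] -/
theorem chi_eq_prod_ite (S : Finset (Fin m)) (y : Fin m → ZMod 2) :
    chi S y = ∏ i, if i ∈ S then sgn (y i) else 1 := by
  rw [chi, ← prod_filter]; simp

/-- `χ_S χ_T = χ_{S ∆ T}`. [folklore] -/
theorem chi_mul_chi (S T : Finset (Fin m)) (y : Fin m → ZMod 2) :
    chi S y * chi T y = chi (symmDiff S T) y := by
  rw [chi_eq_prod_ite, chi_eq_prod_ite, chi_eq_prod_ite, ← prod_mul_distrib]
  refine prod_congr rfl fun i _ => ?_
  simp only [mem_symmDiff]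
  by_cases hS : i ∈ S <;> by_cases hT : i ∈ T <;> simp [hS, hT, sgn_mul_self]

/-- `χ_S² = 1`. [folklore] -/
theorem chi_mul_self (S : Finset (Fin m)) (y : Fin m → ZMod 2) : chi S y * chi S y = 1 := by
  rw [chi_mul_chi, symmDiff_self, Finset.bot_eq_empty, chi_empty]

/-- `χ_S = ±1`. [folklore] -/
theorem chi_eq_one_or (S : Finset (Fin m)) (y : Fin m → ZMod 2) : chi S y = 1 ∨ chi S y = -1 :=
  mul_self_eq_one_iff.1 (chi_mul_self S y)

/-- `χ_S` is a character of `(𝔽₂^m, +)`. [folklore] -/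
theorem chi_add (S : Finset (Fin m)) (y z : Fin m → ZMod 2) :
    chi S (y + z) = chi S y * chi S z := by
  simp only [chi, Pi.add_apply, sgn_add, prod_mul_distrib]

/-- A character flips sign under flipping one of its coordinates: `χ_S(e_i) = -1` for `i ∈ S`.
[folklore] -/
theorem chi_single {S : Finset (Fin m)} {i : Fin m} (hi : i ∈ S) :
    chi S (Pi.single i 1) = -1 := by
  rw [chi, prod_eq_single_of_mem i hi (fun j _ hj => by simp [hj])]
  simp

/-- **Orthogonality over points**: `∑_y χ_S(y) = 2^m [S = ∅]`. [folklore] -/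
theorem sum_chi (S : Finset (Fin m)) :
    ∑ y : Fin m → ZMod 2, chi S y = if S = ∅ then (2 : ℝ) ^ m else 0 := by
  classical
  simp_rw [chi_eq_prod_ite]
  have h := Finset.prod_univ_sum (fun _ : Fin m => (univ : Finset (ZMod 2)))
    (fun i a => if i ∈ S then sgn a else (1 : ℝ))
  rw [Fintype.piFinset_univ] at h
  rw [← h]
  have h2 : ∀ i : Fin m, (∑ a : ZMod 2, if i ∈ S then sgn a else (1 : ℝ)) =
      if i ∈ S then 0 else 2 := by
    intro i
    split_ifs
    · exact sum_sgn
    · norm_num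
  simp_rw [h2]
  split_ifs with hS
  · subst hS
    simp
  · obtain ⟨i, hi⟩ := Finset.nonempty_iff_ne_empty.2 hS
    exact prod_eq_zero (mem_univ i) (if_pos hi)

/-- **Orthogonality over index sets**: `∑_S χ_S(z) = 2^m [z = 0]`. [folklore] -/
theorem sum_chi_index (z : Fin m → ZMod 2) :
    ∑ S : Finset (Fin m), chi S z = if z = 0 then (2 : ℝ) ^ m else 0 := by
  have h : ∑ S : Finset (Fin m), chi S z = ∏ i, (1 + sgn (z i)) := by
    rw [prod_one_add, powerset_univ]; rfl
  rw [h]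
  split_ifs with hz
  · subst hz
    simp only [Pi.zero_apply, sgn_zero, prod_const, card_univ, Fintype.card_fin]
    norm_num
  · obtain ⟨i, hi⟩ : ∃ i, z i ≠ 0 := by
      by_contra h0
      push Not at h0
      exact hz (funext h0)
    apply prod_eq_zero (mem_univ i)
    simp [sgn, hi]

/-! ### Fourier coefficients -/

/-- The Fourier–Walsh coefficient `f̂(S) = 2^{-m} ∑_y f(y) χ_S(y)`. [folklore] -/
def coeff (f : (Fin m → ZMod 2) → ℝ) (S : Finset (Fin m)) : ℝ := (∑ y, f y * chi S y) / 2 ^ m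

/-- `f ↦ f̂(S)` as a linear form. [folklore] -/
def coeffLin (S : Finset (Fin m)) : ((Fin m → ZMod 2) → ℝ) →ₗ[ℝ] ℝ where
  toFun f := coeff f S
  map_add' f g := by
    simp only [coeff, Pi.add_apply, add_mul, sum_add_distrib, add_div]
  map_smul' a f := by
    simp only [coeff, Pi.smul_apply, smul_eq_mul, RingHom.id_apply, mul_assoc, ← mul_sum,
      mul_div_assoc]

/-- `coeffLin S f = f̂(S)`. [folklore] -/
@[simp] theorem coeffLin_apply (S : Finset (Fin m)) (f : (Fin m → ZMod 2) → ℝ) :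
    coeffLin S f = coeff f S := rfl

/-- Coefficients of a character: `(χ_T)^(S) = [S = T]`. [folklore] -/
theorem coeff_chi (S T : Finset (Fin m)) : coeff (chi T) S = if S = T then 1 else 0 := by
  unfold coeff
  simp_rw [chi_mul_chi, sum_chi, Finset.symmDiff_eq_empty]
  have h2 : (2 : ℝ) ^ m ≠ 0 := by positivity
  by_cases h : S = T
  · subst h; simp [h2]
  · rw [if_neg (Ne.symm h), if_neg h, zero_div]

/-- The constant `1` is the trivial character. [folklore] -/
theorem one_eq_chi_empty : (fun _ : Fin m → ZMod 2 => (1 : ℝ)) = chi ∅ := by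
  funext y; simp

/-- **Fourier inversion**: `∑_S f̂(S) χ_S(x) = f(x)`. [folklore] -/
theorem sum_coeff_mul_chi (f : (Fin m → ZMod 2) → ℝ) (x : Fin m → ZMod 2) :
    ∑ S, coeff f S * chi S x = f x := by
  unfold coeff
  have h2 : (2 : ℝ) ^ m ≠ 0 := by positivity
  have e1 : ∀ S : Finset (Fin m), (∑ y, f y * chi S y) / 2 ^ m * chi S x =
      ∑ y, f y * chi S (y + x) / 2 ^ m := by
    intro S
    rw [Finset.sum_div, Finset.sum_mul]
    refine Finset.sum_congr rfl fun y _ => ?_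
    rw [chi_add]; ring
  simp_rw [e1]
  rw [Finset.sum_comm]
  have e2 : ∀ y : Fin m → ZMod 2, ∑ S : Finset (Fin m), f y * chi S (y + x) / 2 ^ m =
      f y * (∑ S : Finset (Fin m), chi S (y + x)) / 2 ^ m := by
    intro y
    rw [Finset.mul_sum, Finset.sum_div]
  simp_rw [e2, sum_chi_index]
  have e3 : ∀ y : Fin m → ZMod 2, (y + x = 0) = (y = x) := by
    intro y
    rw [add_eq_zero_iff_eq_neg]
    congr 1
    funext i
    exact ZMod.neg_eq_self_mod_two (x i)
  simp_rw [e3, mul_ite, mul_zero, ite_div, zero_div]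
  rw [Finset.sum_ite_eq' Finset.univ x]
  simp only [Finset.mem_univ, if_true]
  field_simp

/-- Fourier inversion as an identity of functions: `f = ∑_S f̂(S) • χ_S`. [folklore] -/
theorem eq_sum_coeff_smul_chi (f : (Fin m → ZMod 2) → ℝ) : f = ∑ S, coeff f S • chi S := by
  funext x
  rw [Finset.sum_apply]
  simp only [Pi.smul_apply, smul_eq_mul]
  exact (sum_coeff_mul_chi f x).symm

/-- Registered sub-goal `stub_perfectCompleteness_fourier` of stub `stub_perfectCompleteness`: Fourier
inversion on `𝔽₂^m` in self-contained form (`coeff`, `chi`, `sgn` unfolded). [folklore] -/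
theorem stub_perfectCompleteness_fourier : ∀ (m : ℕ) (f : (Fin m → ZMod 2) → ℝ) (x : Fin m → ZMod 2),
    ∑ S : Finset (Fin m), (∑ y, f y * ∏ i ∈ S, if y i = 0 then (1 : ℝ) else -1) / 2 ^ m *
      ∏ i ∈ S, (if x i = 0 then (1 : ℝ) else -1) = f x :=
  fun _ f x => sum_coeff_mul_chi f x

/-! ### Vanishing coefficients: juntas and low degree -/

/-- A function depending only on the coordinates in `U` has no coefficient outside `U`. [folklore] -/
theorem coeff_eq_zero_of_not_subset {f : (Fin m → ZMod 2) → ℝ} {U T : Finset (Fin m)}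
    (hf : ∀ x y : Fin m → ZMod 2, (∀ i ∈ U, x i = y i) → f x = f y) (hT : ¬ T ⊆ U) :
    coeff f T = 0 := by
  obtain ⟨i, hiT, hiU⟩ := not_subset.1 hT
  set w : Fin m → ZMod 2 := Pi.single i 1 with hw
  have hfw : ∀ y, f (y + w) = f y := fun y => hf _ _ fun j hj => by
    have hji : j ≠ i := fun h => hiU (h ▸ hj)
    simp [hw, hji]
  have key : ∑ y, f y * chi T y = -∑ y, f y * chi T y := by
    calc ∑ y, f y * chi T y = ∑ y, f (y + w) * chi T (y + w) :=
          (Equiv.sum_comp (Equiv.addRight w) (fun y => f y * chi T y)).symm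
      _ = ∑ y, -(f y * chi T y) := by
          refine Finset.sum_congr rfl fun y _ => ?_
          rw [hfw, chi_add, chi_single hiT]; ring
      _ = -∑ y, f y * chi T y := Finset.sum_neg_distrib _
  have h0 : ∑ y, f y * chi T y = 0 := by linarith
  rw [coeff, h0, zero_div]

/-- A linear combination of `k`-juntas has no coefficient of size `> k`. [folklore] -/
theorem coeff_eq_zero_of_mem_span {k : ℕ} {s : (Fin m → ZMod 2) → ℝ}
    (hs : s ∈ Submodule.span ℝ {f : (Fin m → ZMod 2) → ℝ | ∃ S : Finset (Fin m), S.card ≤ k ∧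
      ∀ x y : Fin m → ZMod 2, (∀ i ∈ S, x i = y i) → f x = f y})
    {T : Finset (Fin m)} (hT : k < T.card) : coeff s T = 0 := by
  induction hs using Submodule.span_induction with
  | mem f hf =>
      obtain ⟨S, hS, hfS⟩ := hf
      exact coeff_eq_zero_of_not_subset hfS fun h => absurd (card_le_card h) (by omega)
  | zero => simp [coeff]
  | add f g _ _ hf hg =>
      rw [← coeffLin_apply, map_add, coeffLin_apply, coeffLin_apply, hf, hg, add_zero]
  | smul a f _ hf => rw [← coeffLin_apply, map_smul, coeffLin_apply, hf, smul_zero]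

/-! ### Parity boundaries of an XOR instance -/

variable {V : Type*}

/-- The parity `∑_{v ∈ T} [x ∈ A v] (mod 2)` of the number of equations of `T` containing `x`.
[folklore] -/
def bsum (A : V → Finset (Fin m)) (T : Finset V) (x : Fin m) : ZMod 2 :=
  ∑ v ∈ T, if x ∈ A v then 1 else 0

/-- The boundary `∂T` of a set of equations: the variables lying in an odd number of them (for a
Tseitin instance on a graph: the edges with exactly one endpoint in `T`). [folklore] -/
def bd (A : V → Finset (Fin m)) (T : Finset V) : Finset (Fin m) :=
  univ.filter fun x => bsum A T x = 1

/-- The total charge `∑_{v ∈ T} c v` of a set of equations. [folklore] -/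
def charge (c : V → ZMod 2) (T : Finset V) : ZMod 2 := ∑ v ∈ T, c v

/-- Sums over `𝔽₂` are additive under symmetric difference. [folklore] -/
theorem sum_symmDiff_eq_add [DecidableEq V] (g : V → ZMod 2) (T T' : Finset V) :
    ∑ v ∈ symmDiff T T', g v = ∑ v ∈ T, g v + ∑ v ∈ T', g v := by
  have h2 : ∀ a : ZMod 2, a + a = 0 := by decide
  rw [symmDiff_def, Finset.sup_eq_union, Finset.sum_union disjoint_sdiff_sdiff,
    ← Finset.sum_inter_add_sum_sdiff T T' g, ← Finset.sum_inter_add_sum_sdiff T' T g,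
    Finset.inter_comm T' T]
  set u := ∑ x ∈ T ∩ T', g x
  calc ∑ x ∈ T \ T', g x + ∑ x ∈ T' \ T, g x
      = (u + u) + (∑ x ∈ T \ T', g x + ∑ x ∈ T' \ T, g x) := by rw [h2 u, zero_add]
    _ = u + ∑ x ∈ T \ T', g x + (u + ∑ x ∈ T' \ T, g x) := by ring

/-- `bsum` is additive under symmetric difference. [folklore] -/
theorem bsum_symmDiff [DecidableEq V] (A : V → Finset (Fin m)) (T T' : Finset V) (x : Fin m) :
    bsum A (symmDiff T T') x = bsum A T x + bsum A T' x :=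
  sum_symmDiff_eq_add _ T T'

/-- `charge` is additive under symmetric difference. [folklore] -/
theorem charge_symmDiff [DecidableEq V] (c : V → ZMod 2) (T T' : Finset V) :
    charge c (symmDiff T T') = charge c T + charge c T' :=
  sum_symmDiff_eq_add c T T'

/-- Membership in the boundary. [folklore] -/
@[simp] theorem mem_bd {A : V → Finset (Fin m)} {T : Finset V} {x : Fin m} :
    x ∈ bd A T ↔ bsum A T x = 1 := by
  simp [bd]

/-- `∂(T ∆ T') = ∂T ∆ ∂T'`. [folklore] -/
theorem bd_symmDiff [DecidableEq V] (A : V → Finset (Fin m)) (T T' : Finset V) :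
    bd A (symmDiff T T') = symmDiff (bd A T) (bd A T') := by
  ext x
  rw [mem_bd, bsum_symmDiff, mem_symmDiff, mem_bd, mem_bd]
  rcases eq_zero_or_eq_one (bsum A T x) with h | h <;>
    rcases eq_zero_or_eq_one (bsum A T' x) with h' | h' <;> rw [h, h'] <;> decide

/-- `∂∅ = ∅`. [folklore] -/
@[simp] theorem bd_empty (A : V → Finset (Fin m)) : bd A ∅ = ∅ := by
  ext x; simp [bd, bsum]

/-- `∂{v} = A v`. [folklore] -/
@[simp] theorem bd_singleton (A : V → Finset (Fin m)) (v : V) : bd A {v} = A v := by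
  ext x
  rw [mem_bd, bsum, Finset.sum_singleton]
  by_cases hx : x ∈ A v
  · simp [hx]
  · simp only [hx, if_false, iff_false]
    exact fun h => one_ne_zero h.symm

/-- `charge ∅ = 0`. [folklore] -/
@[simp] theorem charge_empty (c : V → ZMod 2) : charge c ∅ = 0 := by simp [charge]

/-- `charge {v} = c v`. [folklore] -/
@[simp] theorem charge_singleton (c : V → ZMod 2) (v : V) : charge c {v} = c v := by
  simp [charge]

end

end Summit.PneNP.PneNP.Theorems.XorDoor.PC
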